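import Literature.NumberTheory.DiophantineGeometry.KodairaSymbolUnramifiedBaseChangeProofs
import Literature.NumberTheory.DiophantineGeometry.LocalReductionMinimalityProofs
import Literature.NumberTheory.DiophantineGeometry.EllArithGlue
import Literature.NumberTheory.Automorphic.AdicCompletionDegreeOnePlaceProofs
import Literature.NumberTheory.EllipticCurves.Milne1972.WeilRestrictionQuadraticBSDQuotientOfAnyModelProofs
import Literature.NumberTheory.EllipticCurves.ComplexMultiplicationDeuringLocalPlaces
import Literature.NumberTheory.EllipticCurves.Castella2018.TamagawaQuadraticBaseChangeProofs
import Literature.NumberTheory.EllipticCurves.ModularityVersionApProofs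
import Literature.NumberTheory.EllipticCurves.LFunctionPrimeCoeff
import Literature.NumberTheory.EllipticCurves.HeegnerPoints
import Literature.NumberTheory.EllipticCurves.GlobalMinimalModel
import Literature.RingTheory.DiscreteValuationRing.AdicCompletionResidueField
import HarnessLib

/-!
# A global minimal model over `ℚ` stays globally minimal over a quadratic field in which every bad
# prime splits (Heegner hypothesis); hence Dokchitser–Dokchitser's `C(E/K, ω) = ∏_w c_w(E/K)` there
# (PROVED, fact-free)

`Proofs`-style file (theorems only: no definition, no named fact, no instance, no `sorry`;
D-0014/D-0026). Written for the discharge interface of the line `CMKolyvaginAtInertTwo` on the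
leaf `WAllCornerFTwo` (cell `bsd-print-cf2`, seat ty2; item `CMExactDescentAtTwo`): the kernel
descent `Rank1Residual.AdditivePotMult.bsdp_of_pPartOverC_baseChange` is typed on the CANONICAL
model `V = W ⊗ K` of `E_K` with Dokchitser–Dokchitser's modified Tamagawa product
`C(V) = ∏_w c_w |ω_V/ω_w°|_w` (`WeierstrassCurve.modifiedTamagawaProduct`); to read `#Ш_an(V)`
2-adically the prover needs `|ω_V/ω_w°|_w = 1` at every `w`, i.e. that `W ⊗ K` is a MINIMAL model at
every finite place `w` of `K`, for `W/ℚ` globally minimal and `K` an imaginary quadratic field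
satisfying the Heegner hypothesis for `N(W)` (every `ℓ ∣ N` splits). The printed argument:

> Silverman, *AEC* Prop. VII.5.4 (a): "Let `K'/K` be an unramified extension … a minimal
> Weierstrass equation for `E/K` remains minimal over `K'`" — so `W ⊗ K` is minimal at every place
> `w` with `e(w | ℓ) = 1` (tree: the DVR-level persistence theorem
> `WeierstrassCurve.isMinimal_map_of_map_uniformizer`, Step 11 of Tate's algorithm read forwards,
> every residue characteristic, from the discharge files of the fact A233); and at a place above a
> prime `ℓ` of good reduction the minimal discriminant is an `ℓ`-adic unit, so `W ⊗ K` has unit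
> discriminant at `w` and is minimal there (*AEC* VII.1 Remark 1.1). Under the Heegner hypothesis a
> place of `K` is either unramified over `ℚ` or lies over a prime `ℓ ∤ N` (a ramified `ℓ` has ONE
> prime above it, a split one two), so `W ⊗ K` is globally minimal, and `C(W ⊗ K) = ∏_w c_w(W ⊗ K)`
> (tree: `modifiedTamagawaProduct_eq_tamagawaProduct_of_isGloballyMinimal`).

## Results

§1 (number fields `F ⊆ K`, places `w ∣ v`, any elliptic `X/F`; dot-notation on `WeierstrassCurve`):
* `valuation_baseChange_Δ_eq_pow` — `v_w(Δ_{X ⊗ K}) = v_v(Δ_X)^{e(w|v)}`;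
* `isIntegralAt_baseChange_of_isIntegralAt` — `X` integral at `v` ⟹ `X ⊗ K` integral at `w`;
* **`isMinimalAt_baseChange_of_ramificationIdx_eq_one`** — `X` minimal at `v`, `e(w|v) = 1` ⟹
  `X ⊗ K` minimal at `w` (Silverman VII.5.4 (a));
* `isMinimalAt_baseChange_of_valuation_Δ_eq_one` — `X` integral at `v` with `v_v(Δ_X) = 1` ⟹
  `X ⊗ K` minimal at `w` (any ramification).

§2 (`W/ℚ` globally minimal, `K` a number field): `isMinimalAt_baseChange_rat_of_ramificationIdx_eq_one`,
`isMinimalAt_baseChange_rat_of_hasGoodReductionAt`, `isIntegral_ringOfIntegers_baseChange_rat`,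
**`isGloballyMinimal_baseChange_rat`** (every place of `K` unramified over `ℚ` or above a good prime
⟹ `W ⊗ K` globally minimal), and the quadratic Heegner form
**`isGloballyMinimal_baseChange_of_satisfiesHeegnerHypothesis`** (`[K : ℚ] = 2`, every `ℓ ∣ N(W)`
split).

§3 `modifiedTamagawaProduct_baseChange_eq_tamagawaProduct_of_satisfiesHeegnerHypothesis` —
`C(W ⊗ K, ω_W) = ∏_w c_w(W ⊗ K)` in `ℚ` (and the `IsImaginaryQuadratic` form). The square identity
`∏_w c_w(W ⊗ K) = (∏_ℓ c_ℓ(W))²` at a Heegner field is the Summits-side theorem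
`Partition.tamagawaProduct_baseChange_eq_sq_of_allSplit` (not restated here).

Relation to the tree: the Summits-side file
`Summits/…/Theorems/CMKolyvaginAtInertTwoCMExactDescentAtTwoLocal.lean` (seat `bsd-line-cmk2-p1`,
same evening) proves the HEEGNER case of §2–§3 by transport along `ℚ_ℓ ≃ K_w` at places of DEGREE
ONE (`isMinimalAt_baseChange_of_degree_one`, `isGloballyMinimal_baseChange_of_heegner`); the present
Literature file proves Silverman's VII.5.4 (a) at every UNRAMIFIED place of an arbitrary extension of
number fields (inert places included, any residue degree), from which the Heegner case is re-derived;
`isIntegral_ringOfIntegers_baseChange_rat` restates that file's `isIntegral_baseChange_ringOfIntegers`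
(a Literature file cannot import `Summits/…`).

Not here: ramified bad primes (there `W ⊗ K` need not be minimal: `I_n^*` becomes `I_{2n}` after a
`π`-scaling), Tamagawa numbers themselves, anything about `Ш`.

## References

* [SilvermanAEC2009] J. H. Silverman, *The Arithmetic of Elliptic Curves*, 2nd ed. (2009):
  VII.1 Remark 1.1 (unit discriminant ⟹ minimal), Prop. VII.5.4 (a) with proof (p. 197: minimal
  equations stay minimal under unramified extension), VIII.8 (global minimal models).
* [DokchitserDokchitserAnnals2010] T. Dokchitser, V. Dokchitser, *On the Birch–Swinnerton-Dyer
  quotients modulo squares*, Ann. of Math. 172 (2010), §1 Notation (`C(E/K) = ∏ c_v |ω/ω_v°|_v`).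
* [GrossLMS1991] B. H. Gross, *Kolyvagin's work on modular elliptic curves* (1991), §1 (p. 235:
  "all prime factors of `N` are split" in `K`), (1.2).
* [NeukirchANT1999] J. Neukirch, *Algebraic Number Theory* (1999), Ch. I §8 (decomposition of
  primes in an extension; `∑ e_i f_i = n`).
-/

set_option autoImplicit false

noncomputable section

open scoped Classical

open IsDedekindDomain IsLocalRing NumberField
open Literature.NumberTheory.Automorphic Literature.NumberTheory.DiophantineGeometry

/-! ### §0. Uniformisers of `O_v` (private copies of the helpers of
`KodairaSymbolUnramifiedBaseChangeProofs`, which are `private` there) -/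

namespace Literature.NumberTheory.EllipticCurves.HeegnerBaseChange

section Uniformizers

variable {A : Type*} [CommRing A] [IsDedekindDomain A] {K : Type*} [Field K] [Algebra A K]
  [IsFractionRing A K] (v : HeightOneSpectrum A)

/-- `exp (-1)` is a value of `Valued.v` on `O_v` (Mathlib `valuation_exists_uniformizer`). [folklore] -/
private theorem exists_valued_eq_exp_neg_one :
    ∃ π : v.adicCompletionIntegers K, Valued.v (π : v.adicCompletion K) = WithZero.exp (-1 : ℤ) := by
  obtain ⟨x, hx⟩ := v.valuation_exists_uniformizer K
  have hx' : Valued.v ((x : K) : v.adicCompletion K) = WithZero.exp (-1 : ℤ) := by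
    rw [HeightOneSpectrum.valuedAdicCompletion_eq_valuation', hx]
  refine ⟨⟨(x : v.adicCompletion K), ?_⟩, hx'⟩
  rw [HeightOneSpectrum.mem_adicCompletionIntegers, hx', ← WithZero.exp_zero, WithZero.exp_le_exp]
  norm_num

/-- `exp (-1) ≠ 1` in `ℤᵐ⁰`. [folklore] -/
private theorem exp_neg_one_ne_one :
    WithZero.exp (-1 : ℤ) ≠ (1 : WithZero (Multiplicative ℤ)) :=
  ((WithZero.exp_lt_exp.mpr (by norm_num)).trans_eq WithZero.exp_zero).ne

/-- A non-unit of `O_v` has valuation `≤ exp (-1)` (discreteness of `Valued.v`). [folklore] -/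
private theorem valued_le_exp_neg_one_of_not_isUnit {x : v.adicCompletionIntegers K}
    (hx : ¬ IsUnit x) : Valued.v (x : v.adicCompletion K) ≤ WithZero.exp (-1 : ℤ) := by
  rw [HeightOneSpectrum.adicCompletionIntegers.isUnit_iff_valued_eq_one] at hx
  have hle : Valued.v (x : v.adicCompletion K) ≤ 1 := x.2
  rcases eq_or_ne (Valued.v (x : v.adicCompletion K)) 0 with h0 | h0
  · rw [h0]; exact zero_le
  · rw [← WithZero.exp_log h0] at hx hle ⊢
    rw [← WithZero.exp_zero, WithZero.exp_le_exp] at hle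
    have hm0 : WithZero.log (Valued.v (x : v.adicCompletion K)) ≠ 0 := fun h ↦
      hx (by rw [h, WithZero.exp_zero])
    rw [WithZero.exp_le_exp]
    omega

/-- An element of `O_v` is irreducible iff its valuation is `exp (-1)` (the uniformisers of the
complete discrete valuation ring `O_v`; Serre, *Local Fields*, II §1). [folklore] -/
private theorem irreducible_iff_valued_eq_exp_neg_one (x : v.adicCompletionIntegers K) :
    Irreducible x ↔ Valued.v (x : v.adicCompletion K) = WithZero.exp (-1 : ℤ) := by
  constructor
  · intro hx
    obtain ⟨π, hπ⟩ := exists_valued_eq_exp_neg_one (K := K) v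
    have hπu : ¬ IsUnit π := by
      rw [HeightOneSpectrum.adicCompletionIntegers.isUnit_iff_valued_eq_one, hπ]
      exact exp_neg_one_ne_one
    have hπmem : π ∈ maximalIdeal (v.adicCompletionIntegers K) := hπu
    rw [(IsDiscreteValuationRing.irreducible_iff_uniformizer x).mp hx, Ideal.mem_span_singleton]
      at hπmem
    obtain ⟨t, ht⟩ := hπmem
    have hxle := valued_le_exp_neg_one_of_not_isUnit (K := K) v hx.not_isUnit
    have htle : Valued.v (t : v.adicCompletion K) ≤ 1 := t.2
    refine le_antisymm hxle ?_
    have hmul : Valued.v (x : v.adicCompletion K) * Valued.v (t : v.adicCompletion K) =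
        WithZero.exp (-1 : ℤ) := by
      rw [← Valuation.map_mul, ← Subring.coe_mul, ← ht, hπ]
    calc WithZero.exp (-1 : ℤ)
        = Valued.v (x : v.adicCompletion K) * Valued.v (t : v.adicCompletion K) := hmul.symm
      _ ≤ Valued.v (x : v.adicCompletion K) * 1 := by gcongr
      _ = Valued.v (x : v.adicCompletion K) := mul_one _
  · intro hx
    have hxu : ¬ IsUnit x := by
      rw [HeightOneSpectrum.adicCompletionIntegers.isUnit_iff_valued_eq_one, hx]
      exact exp_neg_one_ne_one
    refine ⟨hxu, fun a b hab ↦ ?_⟩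
    by_contra h
    push Not at h
    obtain ⟨ha, hb⟩ := h
    have hale := valued_le_exp_neg_one_of_not_isUnit (K := K) v ha
    have hble := valued_le_exp_neg_one_of_not_isUnit (K := K) v hb
    have hmul : Valued.v (x : v.adicCompletion K) =
        Valued.v (a : v.adicCompletion K) * Valued.v (b : v.adicCompletion K) := by
      rw [← Valuation.map_mul, ← Subring.coe_mul, ← hab]
    have hle : Valued.v (x : v.adicCompletion K) ≤
        WithZero.exp (-1 : ℤ) * WithZero.exp (-1 : ℤ) := by
      rw [hmul]; exact mul_le_mul' hale hble
    rw [hx, ← WithZero.exp_add, WithZero.exp_le_exp] at hle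
    norm_num at hle

end Uniformizers

end Literature.NumberTheory.EllipticCurves.HeegnerBaseChange

/-! ### §1. Base change of integrality / minimality along an extension of number fields `F ⊆ K` -/

namespace WeierstrassCurve

open Literature.NumberTheory.EllipticCurves.HeegnerBaseChange

section NumberFields

variable (F K : Type*) [Field F] [NumberField F] [Field K] [NumberField K] [Algebra F K]
  (v : HeightOneSpectrum (𝓞 F)) (w : HeightOneSpectrum (𝓞 K)) [hw : w.asIdeal.LiesOver v.asIdeal]
  (X : WeierstrassCurve F)

/-- The square `F → F_v → K_w = F → K → K_w` on a Weierstrass model: `(X ⊗ K) ⊗ K_w` is the image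
of `X ⊗ F_v` under the local base-change map `F_v → K_w` (tree `adicCompletionOfLiesOver`).
(Deliberate dot-notation extension of Mathlib's `WeierstrassCurve` namespace; plumbing.) [folklore] -/
private theorem baseChange_baseChange_adicCompletion_eq_map :
    (X.baseChange K).baseChange (w.adicCompletion K) =
      (X.baseChange (v.adicCompletion F)).map (adicCompletionOfLiesOver F K v w) := by
  rw [WeierstrassCurve.baseChange, WeierstrassCurve.baseChange, WeierstrassCurve.baseChange,
    WeierstrassCurve.map_map, WeierstrassCurve.map_map]
  congr 1
  ext x
  rw [RingHom.comp_apply, RingHom.comp_apply, HeightOneSpectrum.algebraMap_adicCompletion,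
    HeightOneSpectrum.algebraMap_adicCompletion, Function.comp_apply, Function.comp_apply,
    Algebra.algebraMap_self_apply, Algebra.algebraMap_self_apply, adicCompletionOfLiesOver_coe]

/-- **`v_w(Δ_{X ⊗ K}) = v_v(Δ_X)^{e(w | v)}`** for an extension of number fields `K ⊇ F` and a place
`w ∣ v` (`e = Ideal.ramificationIdx' v w`): the valuation of `K_w` restricts to the `e`-th power of
that of `F_v` (tree `valued_adicCompletionOfLiesOver`). Neukirch, *ANT* II (4.8)/(8.2).
[cite: NeukirchANT1999, Ch. I §8 (e(w|v)) and Ch. II §8 (extension of valuations)] -/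
theorem valuation_baseChange_Δ_eq_pow :
    w.valuation K (X.baseChange K).Δ =
      v.valuation F X.Δ ^ v.asIdeal.ramificationIdx' w.asIdeal := by
  rw [WeierstrassCurve.baseChange, WeierstrassCurve.map_Δ,
    ← HeightOneSpectrum.valuedAdicCompletion_eq_valuation',
    ← HeightOneSpectrum.valuedAdicCompletion_eq_valuation', ← adicCompletionOfLiesOver_coe F K v w,
    valued_adicCompletionOfLiesOver]

/-- **Integrality base-changes**: if `X` is `v`-integral then `X ⊗ K` is `w`-integral (an
`O_v`-integral equation is `O_w`-integral; first line of the proof of Silverman *AEC* VII.5.4 (a)).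
[cite: SilvermanAEC2009, Prop. VII.5.4 (a) with proof (p. 197)] -/
theorem isIntegralAt_baseChange_of_isIntegralAt (hint : X.IsIntegralAt v) :
    (X.baseChange K).IsIntegralAt w := by
  set ι := adicCompletionOfLiesOver F K v w with hι
  let ιₒ : v.adicCompletionIntegers F →+* w.adicCompletionIntegers K :=
    (ι.comp (v.adicCompletionIntegers F).subtype).codRestrict (w.adicCompletionIntegers K)
      (fun x ↦ adicCompletionOfLiesOver_mem_adicCompletionIntegers F K v w x.2)
  have hc : ∀ r : v.adicCompletionIntegers F,
      ι (algebraMap (v.adicCompletionIntegers F) (v.adicCompletion F) r) =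
        algebraMap (w.adicCompletionIntegers K) (w.adicCompletion K) (ιₒ r) := fun _ ↦ rfl
  haveI : IsIntegral (v.adicCompletionIntegers F) (X.baseChange (v.adicCompletion F)) := hint
  change IsIntegral (w.adicCompletionIntegers K) ((X.baseChange K).baseChange (w.adicCompletion K))
  rw [baseChange_baseChange_adicCompletion_eq_map F K v w X]
  exact isIntegral_map_hom ιₒ ι hc _

/-- **A minimal equation stays minimal at an unramified place (Silverman, *AEC* VII.5.4 (a)).**
For number fields `F ⊆ K`, a place `w` of `K` over the place `v` of `F` with `e(w | v) = 1`, and an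
elliptic curve `X/F` whose model is minimal at `v`, the base change `X ⊗ K` is minimal at `w`:
"Let `K'/K` be an unramified extension … Hence the original equation is also minimal over `K'`".
Proof: the local base-change map `O_v → O_w` sends a uniformiser to a uniformiser (`e = 1`,
`valued_adicCompletionOfLiesOver_of_ramificationIdx_eq_one`), and minimality persists along such a
map in every residue characteristic (tree `isMinimal_map_of_map_uniformizer`: Step 11 of Tate's
algorithm is unreachable on a minimal equation; residue fields finite hence perfect).
[cite: SilvermanAEC2009, Prop. VII.5.4 (a) with proof (p. 197)]
[cite: SilvermanATAEC1994, IV.9.4 Step 11 (PDF pp. 346, 354–355)] -/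
theorem isMinimalAt_baseChange_of_ramificationIdx_eq_one [X.IsElliptic]
    (he : w.asIdeal.ramificationIdx (𝓞 F) = 1) (hmin : X.IsMinimalAt v) :
    (X.baseChange K).IsMinimalAt w := by
  haveI : Finite (ResidueField (v.adicCompletionIntegers F)) :=
    HeightOneSpectrum.finite_residueField_adicCompletionIntegers F v
  haveI : Finite (ResidueField (w.adicCompletionIntegers K)) :=
    HeightOneSpectrum.finite_residueField_adicCompletionIntegers K w
  set ι := adicCompletionOfLiesOver F K v w with hι
  have hval : ∀ y : v.adicCompletion F, Valued.v (ι y) = Valued.v y :=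
    valued_adicCompletionOfLiesOver_of_ramificationIdx_eq_one F K v w he
  -- restriction to the valuation rings
  let ιₒ : v.adicCompletionIntegers F →+* w.adicCompletionIntegers K :=
    (ι.comp (v.adicCompletionIntegers F).subtype).codRestrict (w.adicCompletionIntegers K)
      (fun x ↦ adicCompletionOfLiesOver_mem_adicCompletionIntegers F K v w x.2)
  have hc : ∀ r : v.adicCompletionIntegers F,
      ι (algebraMap (v.adicCompletionIntegers F) (v.adicCompletion F) r) =
        algebraMap (w.adicCompletionIntegers K) (w.adicCompletion K) (ιₒ r) := fun _ ↦ rfl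
  -- `ιₒ` maps a uniformiser to a uniformiser
  obtain ⟨u, hu⟩ : ∃ u : (w.adicCompletionIntegers K)ˣ,
      ιₒ (TateAlgorithm.uniformizer (v.adicCompletionIntegers F)) =
        ↑u * TateAlgorithm.uniformizer (w.adicCompletionIntegers K) := by
    have h1 : Irreducible (ιₒ (TateAlgorithm.uniformizer (v.adicCompletionIntegers F))) := by
      rw [irreducible_iff_valued_eq_exp_neg_one]
      change Valued.v (ι _) = _
      rw [hval]
      exact (irreducible_iff_valued_eq_exp_neg_one v _).mp TateAlgorithm.irreducible_uniformizer
    obtain ⟨u, hu⟩ := IsDiscreteValuationRing.associated_of_irreducible _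
      TateAlgorithm.irreducible_uniformizer h1
    exact ⟨u, by rw [← hu, mul_comm]⟩
  have hΔ : (X.baseChange (v.adicCompletion F)).Δ ≠ 0 := by
    rw [WeierstrassCurve.baseChange, WeierstrassCurve.map_Δ]
    exact (map_ne_zero_iff _ (algebraMap F (v.adicCompletion F)).injective).mpr X.isUnit_Δ.ne_zero
  haveI : IsMinimal (v.adicCompletionIntegers F) (X.baseChange (v.adicCompletion F)) := hmin
  change IsMinimal (w.adicCompletionIntegers K) ((X.baseChange K).baseChange (w.adicCompletion K))
  rw [baseChange_baseChange_adicCompletion_eq_map F K v w X]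
  exact isMinimal_map_of_map_uniformizer ιₒ ι hc hu _ hΔ

/-- **Unit discriminant base-changes to a minimal equation.** If `X` is `v`-integral with
`v_v(Δ_X) = 1` (good reduction of the minimal model), then `X ⊗ K` is `w`-integral with
`v_w(Δ) = 1`, hence minimal at `w` — whatever the ramification of `w ∣ v` (Silverman, *AEC* VII.1
Remark 1.1: an integral equation with `v(Δ) < 12` is minimal).
[cite: SilvermanAEC2009, VII.1 Remark 1.1] -/
theorem isMinimalAt_baseChange_of_valuation_Δ_eq_one [X.IsElliptic] (hint : X.IsIntegralAt v)
    (hΔ : v.valuation F X.Δ = 1) : (X.baseChange K).IsMinimalAt w := by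
  haveI : (X.baseChange K).IsElliptic := by rw [WeierstrassCurve.baseChange]; infer_instance
  refine isMinimalAt_of_lt_valuation_Δ_holds (isIntegralAt_baseChange_of_isIntegralAt F K v w X hint) ?_
  rw [valuation_baseChange_Δ_eq_pow F K v w X, hΔ, one_pow, ← WithZero.exp_zero, WithZero.exp_lt_exp]
  norm_num

end NumberFields

/-! ### §2. `W/ℚ` globally minimal -/

section Rat

variable (W : WeierstrassCurve ℚ) [W.IsElliptic] [W.IsGloballyMinimal]
  (K : Type*) [Field K] [NumberField K]

/-- **`W ⊗ K` is minimal at every place of `K` unramified over `ℚ`** (`W/ℚ` globally minimal; *AEC*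
VII.5.4 (a) at `F = ℚ`, `v = w ∩ 𝓞 ℚ`). [cite: SilvermanAEC2009, Prop. VII.5.4 (a) with proof (p. 197)] -/
theorem isMinimalAt_baseChange_rat_of_ramificationIdx_eq_one (w : HeightOneSpectrum (𝓞 K))
    (he : w.asIdeal.ramificationIdx (𝓞 ℚ) = 1) : (W.baseChange K).IsMinimalAt w := by
  set v : HeightOneSpectrum (𝓞 ℚ) := w.under (𝓞 ℚ) with hv
  haveI : w.asIdeal.LiesOver v.asIdeal := ⟨rfl⟩
  exact isMinimalAt_baseChange_of_ramificationIdx_eq_one ℚ K v w W he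
    (IsGloballyMinimal.isMinimalAt W v)

/-- **`W ⊗ K` is minimal at every place of `K` above a prime of good reduction** (`W/ℚ` globally
minimal: `ord_v Δ_W = ord_v Δ_min = 0`, so `Δ_W` is a `v`-adic unit and `W ⊗ K` has unit
discriminant at `w`; *AEC* VII.1 Remark 1.1 and VII.5.1 (a)).
[cite: SilvermanAEC2009, VII.1 Remark 1.1 and VII.5 Prop. 5.1 (a)] -/
theorem isMinimalAt_baseChange_rat_of_hasGoodReductionAt (w : HeightOneSpectrum (𝓞 K))
    (hgood : W.HasGoodReductionAt (w.under (𝓞 ℚ))) : (W.baseChange K).IsMinimalAt w := by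
  set v : HeightOneSpectrum (𝓞 ℚ) := w.under (𝓞 ℚ) with hv
  haveI : w.asIdeal.LiesOver v.asIdeal := ⟨rfl⟩
  have hmin : W.IsMinimalAt v := IsGloballyMinimal.isMinimalAt W v
  have hord : W.ordMinimalDiscriminant v = 0 := (ordMinimalDiscriminant_eq_zero_iff_holds v W).mpr hgood
  have hΔ : v.valuation ℚ W.Δ = 1 := by
    rw [valuation_Δ_eq_of_isMinimalAt_holds (v := v) (W := W) hmin, hord]
    simp
  have hint : W.IsIntegralAt v := by
    haveI : IsMinimal (v.adicCompletionIntegers ℚ) (W.baseChange (v.adicCompletion ℚ)) := hmin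
    change IsIntegral (v.adicCompletionIntegers ℚ) (W.baseChange (v.adicCompletion ℚ))
    infer_instance
  exact isMinimalAt_baseChange_of_valuation_Δ_eq_one ℚ K v w W hint hΔ

omit [W.IsElliptic] in
/-- `W ⊗ K = W_ℤ ⊗ K` for the integral global minimal model `W_ℤ = integralModelInt W`
(the two ring maps `ℤ → K` agree). [folklore] -/
private theorem baseChange_eq_integralModelInt_baseChange :
    W.baseChange K = (integralModelInt W).baseChange K := by
  have h : (algebraMap ℚ K).comp (Int.castRingHom ℚ) = algebraMap ℤ K := Subsingleton.elim _ _
  conv_lhs => rw [← map_integralModelInt W]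
  rw [WeierstrassCurve.baseChange, WeierstrassCurve.baseChange, WeierstrassCurve.map_map, h]

omit [W.IsElliptic] in
/-- **`W ⊗ K` has coefficients in `𝓞 K`** (they are the images of the integer coefficients of the
global minimal model `W_ℤ`; Silverman *AEC* VIII.8). [cite: SilvermanAEC2009, VIII.8 (global minimal Weierstrass equations)] -/
theorem isIntegral_ringOfIntegers_baseChange_rat : (W.baseChange K).IsIntegral (𝓞 K) := by
  refine ⟨(integralModelInt W).map (algebraMap ℤ (𝓞 K)), ?_⟩
  have h : (algebraMap (𝓞 K) K).comp (algebraMap ℤ (𝓞 K)) = algebraMap ℤ K := Subsingleton.elim _ _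
  rw [baseChange_eq_integralModelInt_baseChange W K, WeierstrassCurve.baseChange,
    WeierstrassCurve.baseChange, WeierstrassCurve.map_map, h]

/-- **A global minimal model over `ℚ` stays globally minimal over `K` when every place of `K` is
unramified over `ℚ` or lies above a prime of good reduction** — in particular when every bad prime
of `W` is unramified in `K` (Silverman *AEC* VII.5.4 (a) place by place, VII.1 Remark 1.1 above
the good primes, VIII.8). [cite: SilvermanAEC2009, Prop. VII.5.4 (a) and VIII.8] -/
theorem isGloballyMinimal_baseChange_rat
    (h : ∀ w : HeightOneSpectrum (𝓞 K),
      w.asIdeal.ramificationIdx (𝓞 ℚ) = 1 ∨ W.HasGoodReductionAt (w.under (𝓞 ℚ))) :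
    (W.baseChange K).IsGloballyMinimal := by
  refine ⟨isIntegral_ringOfIntegers_baseChange_rat W K, fun w ↦ ?_⟩
  rcases h w with he | hgood
  · exact isMinimalAt_baseChange_rat_of_ramificationIdx_eq_one W K w he
  · exact isMinimalAt_baseChange_rat_of_hasGoodReductionAt W K w hgood

omit [W.IsGloballyMinimal] in
/-- **At a quadratic field satisfying the Heegner hypothesis for `N(W)` every place of `K` is
unramified over `ℚ` or lies above a good prime of `W`**: by the trichotomy of places of a quadratic
field over a rational prime (`placesOver_trichotomy_of_finrank_eq_two`: split — two places with
`e = f = 1`; inert — one place with `e = 1`; ramified — one place with `e = 2`), a ramified place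
lies over a prime `ℓ` with ONE prime of `𝓞 K` above it, so `ℓ ∤ N` (the Heegner hypothesis gives
two primes above every `ℓ ∣ N`), i.e. `W` has good reduction at `ℓ`
(`dvd_conductorNorm_iff_not_hasGoodReductionAtPrime`). Gross 1991 §1: "all prime factors of `N`
are split". [cite: GrossLMS1991, §1 (p. 235)] [cite: NeukirchANT1999, Ch. I §8 (8.2)] -/
theorem ramificationIdx_eq_one_or_hasGoodReductionAt_of_satisfiesHeegnerHypothesis
    (h2 : Module.finrank ℚ K = 2)
    (hH : Literature.NumberTheory.EllipticCurves.SatisfiesHeegnerHypothesis (W.conductorNorm ℤ) K)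
    (w : HeightOneSpectrum (𝓞 K)) :
    w.asIdeal.ramificationIdx (𝓞 ℚ) = 1 ∨ W.HasGoodReductionAt (w.under (𝓞 ℚ)) := by
  set v : HeightOneSpectrum (𝓞 ℚ) := w.under (𝓞 ℚ) with hv
  have hwmem : w ∈ {w' : HeightOneSpectrum (𝓞 K) | w'.under (𝓞 ℚ) = v} := rfl
  rcases Literature.NumberTheory.EllipticCurves.placesOver_trichotomy_of_finrank_eq_two K h2 v with
    ⟨w₁, w₂, -, -, hef⟩ | ⟨w', hset, he1, -⟩ | ⟨w', hset, -, -⟩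
  · exact Or.inl (hef w rfl).1
  · rw [hset] at hwmem
    rw [Set.mem_singleton_iff.mp hwmem]
    exact Or.inl he1
  · -- ramified: `ℓ ∤ N`, so `W` has good reduction at `v`
    right
    set ℓ : ℕ := (Rat.HeightOneSpectrum.primesEquiv v : ℕ) with hℓdef
    haveI hℓ : Fact ℓ.Prime := ⟨(Rat.HeightOneSpectrum.primesEquiv v).2⟩
    have hvℓ : (Rat.HeightOneSpectrum.primesEquiv v : ℕ) = ℓ := rfl
    have hone : ((Ideal.span {(ℓ : ℤ)}).primesOver (𝓞 K)).ncard = 1 := by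
      rw [hℓdef, Literature.NumberTheory.EllipticCurves.Castella2018.TamagawaQuadratic.ncard_primesOver_span_eq K v,
        hset, Set.ncard_singleton]
    have hℓN : ¬ ℓ ∣ W.conductorNorm ℤ := fun hdvd ↦ by
      have htwo := hH ℓ hℓ.out hdvd
      omega
    have hgoodℓ : W.HasGoodReductionAtPrime ℓ := by
      by_contra hbad
      exact hℓN ((W.dvd_conductorNorm_iff_not_hasGoodReductionAtPrime ℓ).mpr hbad)
    exact (hasGoodReductionAtPrime_primesEquiv_iff_holds W v ℓ hvℓ).mp hgoodℓ

/-- **A global minimal model over `ℚ` is globally minimal over a quadratic field in which every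
bad prime splits** (`[K : ℚ] = 2` and the Heegner hypothesis for `N(W)`: Gross 1991 §1 "all prime
factors of `N` are split"; Silverman *AEC* VII.5.4 (a), VIII.8).
[cite: SilvermanAEC2009, Prop. VII.5.4 (a) and VIII.8] [cite: GrossLMS1991, §1 (p. 235)] -/
theorem isGloballyMinimal_baseChange_of_satisfiesHeegnerHypothesis (h2 : Module.finrank ℚ K = 2)
    (hH : Literature.NumberTheory.EllipticCurves.SatisfiesHeegnerHypothesis (W.conductorNorm ℤ) K) :
    (W.baseChange K).IsGloballyMinimal :=
  isGloballyMinimal_baseChange_rat W K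
    (ramificationIdx_eq_one_or_hasGoodReductionAt_of_satisfiesHeegnerHypothesis W K h2 hH)

/-! ### §3. Dokchitser–Dokchitser's `C(W ⊗ K) = ∏_w c_w(W ⊗ K)` at a Heegner field -/

/-- **`C(W ⊗ K, ω_W) = ∏_w c_w(W ⊗ K)`** (all Néron correction factors `|ω_W/ω_w°|_w = 1`) for
`W/ℚ` globally minimal and `K` a quadratic field in which every `ℓ ∣ N(W)` splits: the modified
Tamagawa product of Dokchitser–Dokchitser on the canonical model `W ⊗ K` is the plain Tamagawa
product (tree `modifiedTamagawaProduct_eq_tamagawaProduct_of_isGloballyMinimal` for the globally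
minimal `W ⊗ K`). With `∏_w c_w(W ⊗ K) = (∏_ℓ c_ℓ(W))²` (Gross 1991 (1.2); Summits-side
`Partition.tamagawaProduct_baseChange_eq_sq_of_allSplit`) this makes `ord₂ C(W ⊗ K) = 0` whenever
`∏_ℓ c_ℓ(W)` is odd. [cite: DokchitserDokchitserAnnals2010, §1 Notation (arXiv pp. 4–5)]
[cite: GrossLMS1991, §1 (1.2)] -/
theorem modifiedTamagawaProduct_baseChange_eq_tamagawaProduct_of_satisfiesHeegnerHypothesis
    (h2 : Module.finrank ℚ K = 2)
    (hH : Literature.NumberTheory.EllipticCurves.SatisfiesHeegnerHypothesis (W.conductorNorm ℤ) K) :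
    (W.baseChange K).modifiedTamagawaProduct = ((W.baseChange K).tamagawaProduct : ℚ) := by
  haveI : (W.baseChange K).IsElliptic := by rw [WeierstrassCurve.baseChange]; infer_instance
  haveI := isGloballyMinimal_baseChange_of_satisfiesHeegnerHypothesis W K h2 hH
  exact modifiedTamagawaProduct_eq_tamagawaProduct_of_isGloballyMinimal _

/-- The same for every number field `K` each of whose places is unramified over `ℚ` or above a good
prime of `W` (e.g. every bad prime of `W` unramified in `K`).
[cite: DokchitserDokchitserAnnals2010, §1 Notation (arXiv pp. 4–5)]
[cite: SilvermanAEC2009, Prop. VII.5.4 (a) and VIII.8] -/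
theorem modifiedTamagawaProduct_baseChange_eq_tamagawaProduct_of_forall
    (h : ∀ w : HeightOneSpectrum (𝓞 K),
      w.asIdeal.ramificationIdx (𝓞 ℚ) = 1 ∨ W.HasGoodReductionAt (w.under (𝓞 ℚ))) :
    (W.baseChange K).modifiedTamagawaProduct = ((W.baseChange K).tamagawaProduct : ℚ) := by
  haveI : (W.baseChange K).IsElliptic := by rw [WeierstrassCurve.baseChange]; infer_instance
  haveI := isGloballyMinimal_baseChange_rat W K h
  exact modifiedTamagawaProduct_eq_tamagawaProduct_of_isGloballyMinimal _

/-- **The binder shape of the line `CMKolyvaginAtInertTwo`** (`K` imaginary quadratic —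
`IsImaginaryQuadratic K` — satisfying the Heegner hypothesis for `W.conductorNorm ℤ`):
`C(W ⊗ K, ω_W) = ∏_w c_w(W ⊗ K)`. [cite: DokchitserDokchitserAnnals2010, §1 Notation (arXiv pp. 4–5)]
[cite: GrossLMS1991, §1 (p. 235) and (1.2)] -/
theorem modifiedTamagawaProduct_baseChange_eq_tamagawaProduct_of_isImaginaryQuadratic
    {K : Type} [Field K] [NumberField K]
    (hK : Literature.NumberTheory.EllipticCurves.IsImaginaryQuadratic K)
    (hH : Literature.NumberTheory.EllipticCurves.SatisfiesHeegnerHypothesis (W.conductorNorm ℤ) K) :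
    (W.baseChange K).modifiedTamagawaProduct = ((W.baseChange K).tamagawaProduct : ℚ) :=
  modifiedTamagawaProduct_baseChange_eq_tamagawaProduct_of_satisfiesHeegnerHypothesis W K hK.1 hH

end Rat

end WeierstrassCurve
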